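import Summits.HodgeConjecture.HodgeConjecture.Theorems.HodgeLocusCensusCubicTypes
import Summits.HodgeConjecture.HodgeConjecture.Theorems.HodgeLocusCensusSecondComponents
import HarnessLib

/-!
# HodgeLocusCensusCubicRank4 — a valid cubic core certificate decides the rank of Movasati's matrix of a signed plane sum on the Fermat CUBIC FOURFOLD (cell pub-hlocus, LEAD gen 5, (T39))
HONEST FRAMING: certified instances and evidence bearing on the general Hodge conjecture; no claim.

MAIN THEOREM `ivhsRankEq3_of_cert4`: for a class L of coordinate planes of X³_4 twisted on the last three pairs, a certificate Ψ with
`Ψ.valid L = true` and a mode enumeration (modeK, off) over the 1 d = 3 types of `HodgeLocusCensusCubicTypes` with the structure facts H1–H3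
give `IvhsRankEq 4 3 r (PlaneSum.planeList4 L)`, r = Σ_types r_{shape} — the d = 3 transcription of `HodgeLocusCensusPlaneSumRank4.ivhsRankEq_of_cert4`
(pair sums 1 instead of 2, ζ a primitive sixth root with ζ² = ζ − 1 from `primRoot6_facts`, tails on the FIRST 0 pair(s): factors ζ^{Σ i_tail},
ζ^{Σ (j_tail + 1)}). UPPER bound M = U·V through K^r; LOWER bound: the minor on the pivot rows (0, σ_tails ; h, σ_heads − h) and pivot columns
(0, 1 − σ_tails ; g, 1 − σ_heads − g) is (lower triangular, positive-integer diagonal)·(upper triangular, nonzero diagonal) in mode order.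
-/

namespace Summit.HodgeConjecture.HodgeConjecture.HodgeLocus.Census.CubicSum

open TwistCells GrSection

section cert

variable {K : Type*} [Field K] (ζ : K) (L : List (ℤ × ℕ × ℕ × ℕ)) (Ψ : CubicCert) {r : ℕ} (modeK : Fin r → Fin 1) (off : Fin 1 → ℕ)

/-- rows of I_{N} have total degree N = k − 2 = 0. -/
theorem crow_sum4 (i : Fin 6 → ℕ) (hi : i ∈ indexSet 4 3 (4 / 2 * 3 - 4 - 2)) : i 0 + i 1 + i 2 + i 3 + i 4 + i 5 = 0 := by
  have h := (Finset.mem_filter.mp hi).2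
  rw [Finset.sum_fin_eq_sum_range] at h
  simp [Finset.sum_range_succ] at h
  omega

/-- left factor: U[i, m] = [type(i) = type(m)] · ζ^{Σ i_tails} · A_{shape}[head(i), ℓ(m)](ζ). -/
noncomputable def CU4 : Matrix (indexSet 4 3 (4 / 2 * 3 - 4 - 2)) (Fin r) K := fun i m =>
  if i.1 0 + i.1 1 = csig4_0 (modeK m) ∧ i.1 2 + i.1 3 = csig4_1 (modeK m) ∧ i.1 4 + i.1 5 = csig4_2 (modeK m) then
    Z6.eval ζ (Ψ.A (csig4_0 (modeK m)) (csig4_1 (modeK m)) (csig4_2 (modeK m)) (i.1 0) (i.1 2) (i.1 4) (m.1 - off (modeK m))) else 0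

/-- right factor: V[m, j] = [type(j) complementary to type(m)] · ζ^{Σ (j_tail + 1)} · B_{shape}[ℓ(m), head(j)](ζ). -/
noncomputable def CV4 : Matrix (Fin r) (indexSet 4 3 3) K := fun m j =>
  if csig4_0 (modeK m) + (j.1 0 + j.1 1) = 1 ∧ csig4_1 (modeK m) + (j.1 2 + j.1 3) = 1 ∧ csig4_2 (modeK m) + (j.1 4 + j.1 5) = 1 then
    Z6.eval ζ (Ψ.B (csig4_0 (modeK m)) (csig4_1 (modeK m)) (csig4_2 (modeK m)) (m.1 - off (modeK m)) (j.1 0) (j.1 2) (j.1 4)) else 0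

/-- ENTRY FORMULA of M_δ for δ = PlaneSum.planeList4 L on the cubic. -/
theorem ivhsMatrix_cplaneList4_apply (h2 : ζ ^ 2 = ζ - 1) (i : indexSet 4 3 (4 / 2 * 3 - 4 - 2)) (j : indexSet 4 3 3) :
    ivhsMatrix 4 3 ζ (PlaneSum.planeList4 L) i j =
      if i.1 0 + j.1 0 + (i.1 1 + j.1 1) = 1 ∧ i.1 2 + j.1 2 + (i.1 3 + j.1 3) = 1 ∧ i.1 4 + j.1 4 + (i.1 5 + j.1 5) = 1 then
        Z6.eval ζ (core3 L (i.1 0 + j.1 0) (i.1 2 + j.1 2) (i.1 4 + j.1 4)) else 0 := by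
  unfold ivhsMatrix
  rw [periodComb_planeList4_cubic ζ h2]

/-- STRUCTURE THEOREM: M_δ = U · V through K^r. -/
theorem ivhsMatrix_cplaneList4_eq_mul (h2 : ζ ^ 2 = ζ - 1) (hV : Ψ.valid L = true)
    (H1 : ∀ m : Fin r, off (modeK m) ≤ m.1 ∧ m.1 < off (modeK m) + crs4 Ψ (modeK m)) (H2 : ∀ k : Fin 1, off k + crs4 Ψ k ≤ r)
    (H3 : ∀ m : Fin r, ∀ k : Fin 1, off k ≤ m.1 → m.1 < off k + crs4 Ψ k → modeK m = k) :
    ivhsMatrix 4 3 ζ (PlaneSum.planeList4 L) = CU4 ζ Ψ modeK off * CV4 ζ Ψ modeK off := by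
  ext i j
  rw [Matrix.mul_apply, ivhsMatrix_cplaneList4_apply ζ L h2]
  by_cases hex : ∃ k : Fin 1, i.1 0 + i.1 1 = csig4_0 k ∧ i.1 2 + i.1 3 = csig4_1 k ∧ i.1 4 + i.1 5 = csig4_2 k
  · obtain ⟨k₀, q0, q1, q2⟩ := hex
    obtain ⟨l0, l1, l2⟩ := csig_le4 k₀
    have hU : ∀ m : Fin r, modeK m ≠ k₀ → CU4 ζ Ψ modeK off i m = 0 := by
      intro m hm
      unfold CU4
      rw [if_neg]
      intro h
      exact hm (csig_inj4 _ _ (h.1.symm.trans q0) (h.2.1.symm.trans q1) (h.2.2.symm.trans q2))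
    by_cases hc : csig4_0 k₀ + (j.1 0 + j.1 1) = 1 ∧ csig4_1 k₀ + (j.1 2 + j.1 3) = 1 ∧ csig4_2 k₀ + (j.1 4 + j.1 5) = 1
    · rw [if_pos ⟨by omega, by omega, by omega⟩]
      set g : ℕ → K := fun ℓ => Z6.eval ζ (Ψ.A (csig4_0 k₀) (csig4_1 k₀) (csig4_2 k₀) (i.1 0) (i.1 2) (i.1 4) ℓ) *
        (Z6.eval ζ (Ψ.B (csig4_0 k₀) (csig4_1 k₀) (csig4_2 k₀) ℓ (j.1 0) (j.1 2) (j.1 4))) with hg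
      have hterm : ∀ m : Fin r, CU4 ζ Ψ modeK off i m * CV4 ζ Ψ modeK off m j = if modeK m = k₀ then g (m.1 - off k₀) else 0 := by
        intro m
        by_cases hm : modeK m = k₀
        · rw [if_pos hm, hg]
          unfold CU4 CV4
          rw [hm, if_pos ⟨q0, q1, q2⟩, if_pos hc]
        · rw [if_neg hm, hU m hm, zero_mul]
      rw [Finset.sum_congr rfl fun m _ => hterm m, PlaneSum.sum_modes modeK off (crs4 Ψ) H1 H2 H3 k₀ g,
        ← CubicCert.factor_eq hV (s0 := csig4_0 k₀) (s1 := csig4_1 k₀) (s2 := csig4_2 k₀) (a := i.1 0) (b := i.1 2) (e := i.1 4)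
          (a' := j.1 0) (b' := j.1 2) (e' := j.1 4) (by omega) (by omega) (by omega) (by omega) (by omega) (by omega) (by omega) (by omega) (by omega), Z6.eval_rsum]
      exact Finset.sum_congr rfl fun ℓ _ => by
        rw [hg, Z6.eval_mul ζ h2]
    · rw [if_neg fun h => hc ⟨by omega, by omega, by omega⟩]
      symm
      refine Finset.sum_eq_zero fun m _ => ?_
      by_cases hm : modeK m = k₀
      · unfold CV4
        rw [hm, if_neg hc, mul_zero]
      · rw [hU m hm, zero_mul]
  · -- a row with some pair sum > 1 (no type): both sides vanish
    have hsum := crow_sum4 i.1 i.2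
    have hU : ∀ m : Fin r, CU4 ζ Ψ modeK off i m = 0 := fun m => by
      unfold CU4
      exact if_neg fun h => hex ⟨modeK m, h⟩
    rw [Finset.sum_eq_zero fun m _ => by rw [hU m, zero_mul], if_neg]
    intro hc
    obtain ⟨c0, c1, c2⟩ := hc
    exact hex (csig_cover4' (i.1 0 + i.1 1) (i.1 2 + i.1 3) (i.1 4 + i.1 5) (by omega) (by omega) (by omega)
      (by omega))

/-- UPPER BOUND: rank M_δ ≤ r. -/
theorem crank_le_of_cert4 (h2 : ζ ^ 2 = ζ - 1) (hV : Ψ.valid L = true)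
    (H1 : ∀ m : Fin r, off (modeK m) ≤ m.1 ∧ m.1 < off (modeK m) + crs4 Ψ (modeK m)) (H2 : ∀ k : Fin 1, off k + crs4 Ψ k ≤ r)
    (H3 : ∀ m : Fin r, ∀ k : Fin 1, off k ≤ m.1 → m.1 < off k + crs4 Ψ k → modeK m = k) :
    (ivhsMatrix 4 3 ζ (PlaneSum.planeList4 L)).rank ≤ r := by
  rw [ivhsMatrix_cplaneList4_eq_mul ζ L Ψ modeK off h2 hV H1 H2 H3]
  exact (Matrix.rank_mul_le_left _ _).trans (by simpa using Matrix.rank_le_card_width (CU4 ζ Ψ modeK off))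

/-! ### the witness minor -/

/-- the row (0, σ_tails ; h, σ_heads − h) of type k with head h … -/
def cRow4 (k : Fin 1) (h : ℕ × ℕ × ℕ) : Fin 6 → ℕ :=
  ![h.1, csig4_0 k - h.1, h.2.1, csig4_1 k - h.2.1, h.2.2, csig4_2 k - h.2.2]
/-- … and the column (0, 1 − σ_tails ; g, 1 − σ_heads − g) of the complementary type with head g. -/
def cCol4 (k : Fin 1) (g : ℕ × ℕ × ℕ) : Fin 6 → ℕ :=
  ![g.1, 1 - csig4_0 k - g.1, g.2.1, 1 - csig4_1 k - g.2.1, g.2.2, 1 - csig4_2 k - g.2.2]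

/-- the pivot rows lie in I_{k−2} … -/
theorem cRow4_mem (k : Fin 1) (h : ℕ × ℕ × ℕ) (hb : h.1 ≤ csig4_0 k ∧ h.2.1 ≤ csig4_1 k ∧ h.2.2 ≤ csig4_2 k) :
    cRow4 k h ∈ indexSet 4 3 (4 / 2 * 3 - 4 - 2) := by
  obtain ⟨l0, l1, l2⟩ := csig_le4 k
  have hs := csig_sum4 k
  unfold indexSet
  simp only [Finset.mem_filter, Fintype.mem_piFinset, Finset.mem_range, Fin.forall_fin_succ, Fin.sum_univ_succ]
  simp [cRow4]
  omega

/-- … and the pivot columns in I_3. -/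
theorem cCol4_mem (k : Fin 1) (g : ℕ × ℕ × ℕ) (hb : g.1 ≤ 1 - csig4_0 k ∧ g.2.1 ≤ 1 - csig4_1 k ∧ g.2.2 ≤ 1 - csig4_2 k) :
    cCol4 k g ∈ indexSet 4 3 3 := by
  obtain ⟨l0, l1, l2⟩ := csig_le4 k
  have hs := csig_sum4 k
  unfold indexSet
  simp only [Finset.mem_filter, Fintype.mem_piFinset, Finset.mem_range, Fin.forall_fin_succ, Fin.sum_univ_succ]
  simp [cCol4]
  omega

/-- heads, tails and pair sums of a pivot row … -/
theorem cRow4_val (k : Fin 1) (h : ℕ × ℕ × ℕ) (hb : h.1 ≤ csig4_0 k ∧ h.2.1 ≤ csig4_1 k ∧ h.2.2 ≤ csig4_2 k) :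
    cRow4 k h 0 = h.1 ∧
    cRow4 k h 2 = h.2.1 ∧
    cRow4 k h 4 = h.2.2 ∧
    cRow4 k h 0 + cRow4 k h 1 = csig4_0 k ∧
    cRow4 k h 2 + cRow4 k h 3 = csig4_1 k ∧
    cRow4 k h 4 + cRow4 k h 5 = csig4_2 k := by
  simp [cRow4]
  omega

/-- … and of a pivot column. -/
theorem cCol4_val (k : Fin 1) (g : ℕ × ℕ × ℕ) (hb : g.1 ≤ 1 - csig4_0 k ∧ g.2.1 ≤ 1 - csig4_1 k ∧ g.2.2 ≤ 1 - csig4_2 k) :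
    cCol4 k g 0 = g.1 ∧
    cCol4 k g 2 = g.2.1 ∧
    cCol4 k g 4 = g.2.2 ∧
    csig4_0 k + (cCol4 k g 0 + cCol4 k g 1) = 1 ∧
    csig4_1 k + (cCol4 k g 2 + cCol4 k g 3) = 1 ∧
    csig4_2 k + (cCol4 k g 4 + cCol4 k g 5) = 1 := by
  obtain ⟨l0, l1, l2⟩ := csig_le4 k
  simp [cCol4]
  omega

variable {L Ψ modeK off}

/-- ℓ(m) < r_{shape(m)}. -/
theorem cmodeL_lt4 (H1 : ∀ m : Fin r, off (modeK m) ≤ m.1 ∧ m.1 < off (modeK m) + crs4 Ψ (modeK m)) (m : Fin r) :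
    m.1 - off (modeK m) < crs4 Ψ (modeK m) := by
  have := H1 m
  omega

/-- the box facts of the pivots of mode m. -/
theorem cpivot_box4 (hV : Ψ.valid L = true) (H1 : ∀ m : Fin r, off (modeK m) ≤ m.1 ∧ m.1 < off (modeK m) + crs4 Ψ (modeK m)) (m : Fin r) :
    ((Ψ.rowP (csig4_0 (modeK m)) (csig4_1 (modeK m)) (csig4_2 (modeK m)) (m.1 - off (modeK m))).1 ≤ csig4_0 (modeK m) ∧ (Ψ.rowP (csig4_0 (modeK m)) (csig4_1 (modeK m)) (csig4_2 (modeK m)) (m.1 - off (modeK m))).2.1 ≤ csig4_1 (modeK m) ∧ (Ψ.rowP (csig4_0 (modeK m)) (csig4_1 (modeK m)) (csig4_2 (modeK m)) (m.1 - off (modeK m))).2.2 ≤ csig4_2 (modeK m)) ∧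
    ((Ψ.colP (csig4_0 (modeK m)) (csig4_1 (modeK m)) (csig4_2 (modeK m)) (m.1 - off (modeK m))).1 ≤ 1 - csig4_0 (modeK m) ∧ (Ψ.colP (csig4_0 (modeK m)) (csig4_1 (modeK m)) (csig4_2 (modeK m)) (m.1 - off (modeK m))).2.1 ≤ 1 - csig4_1 (modeK m) ∧ (Ψ.colP (csig4_0 (modeK m)) (csig4_1 (modeK m)) (csig4_2 (modeK m)) (m.1 - off (modeK m))).2.2 ≤ 1 - csig4_2 (modeK m)) := by
  obtain ⟨l0, l1, l2⟩ := csig_le4 (modeK m)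
  obtain ⟨-, -, hb⟩ := CubicCert.pivots hV (by omega) (by omega) (by omega) (cmodeL_lt4 H1 m)
  exact ⟨⟨hb.1, hb.2.1, hb.2.2.1⟩, hb.2.2.2⟩

/-- the pivot row of mode m … -/
def crho4 (hV : Ψ.valid L = true) (H1 : ∀ m : Fin r, off (modeK m) ≤ m.1 ∧ m.1 < off (modeK m) + crs4 Ψ (modeK m)) (m : Fin r) :
    indexSet 4 3 (4 / 2 * 3 - 4 - 2) :=
  ⟨cRow4 (modeK m) (Ψ.rowP (csig4_0 (modeK m)) (csig4_1 (modeK m)) (csig4_2 (modeK m)) (m.1 - off (modeK m))), cRow4_mem _ _ (cpivot_box4 hV H1 m).1⟩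

/-- … and its pivot column. -/
def cgam4 (hV : Ψ.valid L = true) (H1 : ∀ m : Fin r, off (modeK m) ≤ m.1 ∧ m.1 < off (modeK m) + crs4 Ψ (modeK m)) (m : Fin r) :
    indexSet 4 3 3 :=
  ⟨cCol4 (modeK m) (Ψ.colP (csig4_0 (modeK m)) (csig4_1 (modeK m)) (csig4_2 (modeK m)) (m.1 - off (modeK m))), cCol4_mem _ _ (cpivot_box4 hV H1 m).2⟩

/-- heads, tails and pair sums of ρ(m) … -/
theorem crho4_val (hV : Ψ.valid L = true) (H1 : ∀ m : Fin r, off (modeK m) ≤ m.1 ∧ m.1 < off (modeK m) + crs4 Ψ (modeK m)) (m : Fin r) :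
    (crho4 hV H1 m).1 0 = (Ψ.rowP (csig4_0 (modeK m)) (csig4_1 (modeK m)) (csig4_2 (modeK m)) (m.1 - off (modeK m))).1 ∧
    (crho4 hV H1 m).1 2 = (Ψ.rowP (csig4_0 (modeK m)) (csig4_1 (modeK m)) (csig4_2 (modeK m)) (m.1 - off (modeK m))).2.1 ∧
    (crho4 hV H1 m).1 4 = (Ψ.rowP (csig4_0 (modeK m)) (csig4_1 (modeK m)) (csig4_2 (modeK m)) (m.1 - off (modeK m))).2.2 ∧
    (crho4 hV H1 m).1 0 + (crho4 hV H1 m).1 1 = csig4_0 (modeK m) ∧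
    (crho4 hV H1 m).1 2 + (crho4 hV H1 m).1 3 = csig4_1 (modeK m) ∧
    (crho4 hV H1 m).1 4 + (crho4 hV H1 m).1 5 = csig4_2 (modeK m) :=
  cRow4_val (modeK m) _ (cpivot_box4 hV H1 m).1

/-- … and of γ(m). -/
theorem cgam4_val (hV : Ψ.valid L = true) (H1 : ∀ m : Fin r, off (modeK m) ≤ m.1 ∧ m.1 < off (modeK m) + crs4 Ψ (modeK m)) (m : Fin r) :
    (cgam4 hV H1 m).1 0 = (Ψ.colP (csig4_0 (modeK m)) (csig4_1 (modeK m)) (csig4_2 (modeK m)) (m.1 - off (modeK m))).1 ∧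
    (cgam4 hV H1 m).1 2 = (Ψ.colP (csig4_0 (modeK m)) (csig4_1 (modeK m)) (csig4_2 (modeK m)) (m.1 - off (modeK m))).2.1 ∧
    (cgam4 hV H1 m).1 4 = (Ψ.colP (csig4_0 (modeK m)) (csig4_1 (modeK m)) (csig4_2 (modeK m)) (m.1 - off (modeK m))).2.2 ∧
    csig4_0 (modeK m) + ((cgam4 hV H1 m).1 0 + (cgam4 hV H1 m).1 1) = 1 ∧
    csig4_1 (modeK m) + ((cgam4 hV H1 m).1 2 + (cgam4 hV H1 m).1 3) = 1 ∧
    csig4_2 (modeK m) + ((cgam4 hV H1 m).1 4 + (cgam4 hV H1 m).1 5) = 1 :=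
  cCol4_val (modeK m) _ (cpivot_box4 hV H1 m).2

/-- U on a pivot row: supported on the modes of the same type, with value ζ⁰ · A_shape[h_{ℓ(m)}, ℓ(m')]. -/
theorem CU4_rho (hV : Ψ.valid L = true) (H1 : ∀ m : Fin r, off (modeK m) ≤ m.1 ∧ m.1 < off (modeK m) + crs4 Ψ (modeK m)) (m m' : Fin r) :
    CU4 ζ Ψ modeK off (crho4 hV H1 m) m' = if modeK m' = modeK m then
      Z6.eval ζ (Ψ.A (csig4_0 (modeK m)) (csig4_1 (modeK m)) (csig4_2 (modeK m))
        (Ψ.rowP (csig4_0 (modeK m)) (csig4_1 (modeK m)) (csig4_2 (modeK m)) (m.1 - off (modeK m))).1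
        (Ψ.rowP (csig4_0 (modeK m)) (csig4_1 (modeK m)) (csig4_2 (modeK m)) (m.1 - off (modeK m))).2.1
        (Ψ.rowP (csig4_0 (modeK m)) (csig4_1 (modeK m)) (csig4_2 (modeK m)) (m.1 - off (modeK m))).2.2 (m'.1 - off (modeK m))) else 0 := by
  obtain ⟨ea, eb, ee, p0, p1, p2⟩ := crho4_val hV H1 m
  unfold CU4
  rw [p0, p1, p2, ea, eb, ee]
  by_cases hk : modeK m' = modeK m
  · rw [if_pos hk, hk, if_pos ⟨rfl, rfl, rfl⟩]
  · rw [if_neg hk, if_neg]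
    intro h
    exact hk (csig_inj4 _ _ h.1.symm h.2.1.symm h.2.2.symm)

/-- V on a pivot column: supported on the modes of the same type, with value ζ^{tails} · B_shape[ℓ(m), g_{ℓ(m')}]. -/
theorem CV4_gam (hV : Ψ.valid L = true) (H1 : ∀ m : Fin r, off (modeK m) ≤ m.1 ∧ m.1 < off (modeK m) + crs4 Ψ (modeK m)) (m m' : Fin r) :
    CV4 ζ Ψ modeK off m (cgam4 hV H1 m') = if modeK m = modeK m' then
      Z6.eval ζ (Ψ.B (csig4_0 (modeK m')) (csig4_1 (modeK m')) (csig4_2 (modeK m')) (m.1 - off (modeK m'))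
        (Ψ.colP (csig4_0 (modeK m')) (csig4_1 (modeK m')) (csig4_2 (modeK m')) (m'.1 - off (modeK m'))).1
        (Ψ.colP (csig4_0 (modeK m')) (csig4_1 (modeK m')) (csig4_2 (modeK m')) (m'.1 - off (modeK m'))).2.1
        (Ψ.colP (csig4_0 (modeK m')) (csig4_1 (modeK m')) (csig4_2 (modeK m')) (m'.1 - off (modeK m'))).2.2) else 0 := by
  obtain ⟨ea, eb, ee, p0, p1, p2⟩ := cgam4_val hV H1 m'
  unfold CV4
  by_cases hk : modeK m = modeK m'
  · rw [if_pos hk, hk, p0, p1, p2, ea, eb, ee, if_pos ⟨rfl, rfl, rfl⟩]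
  · rw [if_neg hk, if_neg]
    intro h
    exact hk (csig_inj4 _ _ (by omega) (by omega) (by omega))

/-- LOWER BOUND: rank M_δ ≥ r. -/
theorem cle_rank_of_cert4 [CharZero K] (h2 : ζ ^ 2 = ζ - 1) (hV : Ψ.valid L = true)
    (H1 : ∀ m : Fin r, off (modeK m) ≤ m.1 ∧ m.1 < off (modeK m) + crs4 Ψ (modeK m)) (H2 : ∀ k : Fin 1, off k + crs4 Ψ k ≤ r)
    (H3 : ∀ m : Fin r, ∀ k : Fin 1, off k ≤ m.1 → m.1 < off k + crs4 Ψ k → modeK m = k) :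
    r ≤ (ivhsMatrix 4 3 ζ (PlaneSum.planeList4 L)).rank := by
  classical
  have hz : ζ ≠ 0 := by
    rintro rfl
    norm_num at h2
  set M := ivhsMatrix 4 3 ζ (PlaneSum.planeList4 L) with hM
  have hS : M.submatrix (crho4 hV H1) (cgam4 hV H1) =
      (CU4 ζ Ψ modeK off).submatrix (crho4 hV H1) id * (CV4 ζ Ψ modeK off).submatrix id (cgam4 hV H1) := by
    rw [hM, ivhsMatrix_cplaneList4_eq_mul ζ L Ψ modeK off h2 hV H1 H2 H3]
    exact Matrix.submatrix_mul _ _ _ _ _ Function.bijective_id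
  -- the left factor of the minor is lower triangular with nonzero diagonal
  have hUt : ((CU4 ζ Ψ modeK off).submatrix (crho4 hV H1) id).BlockTriangular OrderDual.toDual := by
    intro m m' hlt
    have hlt' : m < m' := OrderDual.toDual_lt_toDual.mp hlt
    rw [Matrix.submatrix_apply, id_eq, CU4_rho ζ hV H1]
    by_cases hk : modeK m' = modeK m
    · rw [if_pos hk]
      obtain ⟨l0, l1, l2⟩ := csig_le4 (modeK m)
      obtain ⟨hℓ, hℓ'⟩ := PlaneSum.modeL_lt_of_lt modeK off (crs4 Ψ) H1 hlt' hk
      rw [CubicCert.A_upper_zero hV (by omega) (by omega) (by omega) (cmodeL_lt4 H1 m) hℓ' hℓ, Z6.zero_def, Z6.eval_zero]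
    · rw [if_neg hk]
  have hUd : ∀ m : Fin r, ((CU4 ζ Ψ modeK off).submatrix (crho4 hV H1) id) m m ≠ 0 := by
    intro m
    rw [Matrix.submatrix_apply, id_eq, CU4_rho ζ hV H1, if_pos rfl]
    obtain ⟨l0, l1, l2⟩ := csig_le4 (modeK m)
    exact Z6.eval_ne_zero_of_posConst ζ (CubicCert.pivots hV (by omega) (by omega) (by omega) (cmodeL_lt4 H1 m)).1
  -- the right factor of the minor is upper triangular with nonzero diagonal
  have hVt : ((CV4 ζ Ψ modeK off).submatrix id (cgam4 hV H1)).BlockTriangular id := by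
    intro m m' hlt
    have hlt' : m' < m := hlt
    rw [Matrix.submatrix_apply, id_eq, CV4_gam ζ hV H1]
    by_cases hk : modeK m = modeK m'
    · rw [if_pos hk]
      obtain ⟨l0, l1, l2⟩ := csig_le4 (modeK m')
      obtain ⟨hℓ, hℓ'⟩ := PlaneSum.modeL_lt_of_lt modeK off (crs4 Ψ) H1 hlt' hk
      rw [CubicCert.B_lower_zero hV (by omega) (by omega) (by omega) (cmodeL_lt4 H1 m') hℓ' hℓ, Z6.zero_def, Z6.eval_zero]
    · rw [if_neg hk]
  have hVd : ∀ m : Fin r, ((CV4 ζ Ψ modeK off).submatrix id (cgam4 hV H1)) m m ≠ 0 := by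
    intro m
    rw [Matrix.submatrix_apply, id_eq, CV4_gam ζ hV H1, if_pos rfl]
    obtain ⟨l0, l1, l2⟩ := csig_le4 (modeK m)
    have hBw := Z6.eval_ne_zero_of_posConst ζ (CubicCert.pivots hV (by omega) (by omega) (by omega) (cmodeL_lt4 H1 m)).2.1
    rw [Z6.eval_mul ζ h2] at hBw
    exact left_ne_zero_of_mul hBw
  have hdet : IsUnit (M.submatrix (crho4 hV H1) (cgam4 hV H1)).det := by
    rw [hS, Matrix.det_mul, Matrix.det_of_lowerTriangular _ hUt, Matrix.det_of_upperTriangular hVt]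
    exact isUnit_iff_ne_zero.mpr (mul_ne_zero (Finset.prod_ne_zero_iff.mpr fun m _ => hUd m)
      (Finset.prod_ne_zero_iff.mpr fun m _ => hVd m))
  have hrank : (M.submatrix (crho4 hV H1) (cgam4 hV H1)).rank = r := by
    rw [Matrix.rank_of_isUnit _ ((Matrix.isUnit_iff_isUnit_det _).mpr hdet), Fintype.card_fin]
  calc r = (M.submatrix (crho4 hV H1) (cgam4 hV H1)).rank := hrank.symm
    _ ≤ M.rank := Matrix.rank_submatrix_le M _ _

/-- MAIN THEOREM (cubic, n = 4): a valid cubic core certificate with a mode enumeration decides the row `IvhsRankEq 4 3 r (PlaneSum.planeList4 L)`. -/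
theorem ivhsRankEq3_of_cert4 (L : List (ℤ × ℕ × ℕ × ℕ)) (Ψ : CubicCert) (hV : Ψ.valid L = true) {r : ℕ} (modeK : Fin r → Fin 1)
    (off : Fin 1 → ℕ) (H1 : ∀ m : Fin r, off (modeK m) ≤ m.1 ∧ m.1 < off (modeK m) + crs4 Ψ (modeK m))
    (H2 : ∀ k : Fin 1, off k + crs4 Ψ k ≤ r) (H3 : ∀ m : Fin r, ∀ k : Fin 1, off k ≤ m.1 → m.1 < off k + crs4 Ψ k → modeK m = k) :
    IvhsRankEq 4 3 r (PlaneSum.planeList4 L) := by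
  intro K _ _ ζ hζ
  have h2 : ζ ^ 2 = ζ - 1 := (primRoot6_facts ζ hζ).2.2
  exact le_antisymm (crank_le_of_cert4 ζ L Ψ modeK off h2 hV H1 H2 H3) (cle_rank_of_cert4 ζ h2 hV H1 H2 H3)

end cert

end Summit.HodgeConjecture.HodgeConjecture.HodgeLocus.Census.CubicSum
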